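import Summits.CriticalPhenomena.PercolationContinuityZ3.Theorems.PercNearOneGluingNoHeavyQuantGatedSliceMixLawRegimeBTwoMid
import HarnessLib

/-!
# QUANT lane R8, T-DEC, leg (III), blob case — `LawDec.GatedSliceMixLaw'` in REGIME B, cell B-M with TWO mids: the top `k₂` of the
# two-point law a mid BELOW the weak-mid atom (`k₂ < h ≤ j`), `k₂` SATURATED by the shifted low, the unshifted low CHEAP at `h` (companion
# of `…QuantGatedSliceMixLawRegimeBTwoMid`, which has the tools and the dear twin)

builds on p205010 (kernel theorem, internal audit signed; external expert review pending)

Support file (`--supports stmt-CriticalPhenomena-4575`), QUANT lane seat prim-quant-census-2 (gen 61), rung R8 of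
`run/shared/lean/prim/quant/LADDER.md`.  Memo `run/shared/lean/prim/quant/prim-quant-census-2-g61/REGIME-B-TOP-G61.md` §5.  Theorems only,
standard axioms, no sorries.  Tools: `…QuantGatedSliceMixLawPooled` (`pooled_dear`, `pooled_cheap`, `usage_mid_le_of_rho_le`),
`…QuantGatedSliceMixLawExchange` (`flowAtT_pair`, `movedTwoPoint_apply`, `gatedSliceMixLaw_conclusion_of_flowAtT`), `flowAtT_of_giants`.

THE CELL (see the companion's header for the structure).  Regime B (`h + a ≥ j+1`), `k₂` a mid with `k₂ + a ≥ j+1` and `k₂ < h`, `k₁` and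
`ℓ = k₁ + a` `t`-lows, `g < 1`.  Here the unshifted low is CHEAP (light) at the relevant mid, so it rides a mid rather than a giant; the giant
inequality again follows from the pooled inequality of the pair `(k₁, k₂)` (`…Pooled`) and the monotonicity of `usage` in the height of the mid.
Exact census of the seat: 0 exceptions on the sub-cells (memo §5).

* **`LawDec.gatedSliceMixLaw_regimeB_twoMid_cheap`** — the conclusion of `GatedSliceMixLaw'` on the sub-cell `k₂ < h`, `m₂ ≤ U(ℓ,k₂)m₁'`,
  `k₁` cheap at `h` (`t − 2k₁ ≤ y(h − k₁)`): both lows ride `W_h`'s mid after `ℓ` fills `k₂`; `pooled_cheap`/`pooled_dear` of `(k₁,k₂)`.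
* **`LawDec.gatedSliceMixLaw_regimeB_twoMid_unsat`** — the sub-cell `k₂ < h`, `U(ℓ,k₂)m₁' ≤ m₂ ≤ U(ℓ,k₂)m₁' + U(k₁,k₂)m₁`, `k₁` cheap at `k₂`:
  `ℓ` and part of `k₁` fill `k₂`, the overflow of `k₁` rides `W_h`'s mid; `pooled_cheap` of `(k₁,k₂)`.  (The remainder
  `m₂ > U(ℓ,k₂)m₁' + [cheap]·U(k₁,k₂)m₁` of the two-mid cell `k₂ < h` is a θ = 0 cell — the moved law alone.)

[this work]; exchange architecture: prim-quant-stmt g30; flow form / criterion E: prim-quant-stmt g22–g27, arm-1 g39; kink map: arm-3 g63–g64,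
lead g31–g32 (this lane).  Nothing here is cited as a published result.  The gluing rows served [cite: KozmaNitzan2024, Conjecture 3 (p. 15)];
product measure [cite: Grimmett1999, §1.3 p. 10].
-/

noncomputable section

namespace Summit.CriticalPhenomena.PercolationContinuityZ3.Theorems

namespace Quant

open Finset

/-- the two-point law `{lo, hi; g}` (as in `…QuantLawDEC`) -/
local notation3 "TP[" lo ", " hi ", " g ", " h "]" =>
  (g : ℝ) * (if (h : ℕ) = (hi : ℕ) then (1 : ℝ) else 0) + (1 - (g : ℝ)) * (if (h : ℕ) = (lo : ℕ) then (1 : ℝ) else 0)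

namespace LawDec

set_option maxHeartbeats 1600000 in
/-- **REGIME B, TWO MIDS `k₂ < h`, `k₂` SATURATED, CHEAP `k₁` — the conclusion of `GatedSliceMixLaw'`.**  As
`gatedSliceMixLaw_regimeB_twoMid_dear` but `k₁` light at `h` (`t − 2k₁ ≤ y(h − k₁)`): `k₁` rides `W_h`'s mid too,
`D = U(ℓ,h)N_ℓ + U(k₁,h)m₁`; giant inequality from `pooled_cheap` / `pooled_dear` (top `k₂`) and `U(·,h) ≤ U(·,k₂)`, `U(k₁,h) ≤ u`. [this work] -/
theorem gatedSliceMixLaw_regimeB_twoMid_cheap (y z g S lam : ℝ) (a j M h k₁ k₂ : ℕ)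
    (hy0 : 0 < y) (hy1 : y < 1) (hz0 : 0 ≤ z) (hz1 : z < 1) (hg1 : g < 1) (hyg : y ≤ (1 - z) * g)
    (hS0 : 0 < S) (hta : y * (M : ℝ) ≤ S) (hhj : h ≤ j) (hhM : h ≤ M) (hSh : S < (h : ℝ))
    (hk : k₁ ≤ k₂) (hk₂M : k₂ ≤ M) (hlam0 : 0 ≤ lam) (hlam1 : lam ≤ 1)
    (hmean : (1 - z) * ((k₁ : ℝ) + ((k₂ : ℝ) - k₁) * lam) = S)
    (hk₁j : k₁ ≤ j) (hk1low : 2 * (k₁ : ℝ) < S + (a : ℝ) * g * (1 - z))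
    (hllow : 2 * ((k₁ + a : ℕ) : ℝ) < S + (a : ℝ) * g * (1 - z)) (hlj : k₁ + a ≤ j) (hk₂aG : j + 1 ≤ k₂ + a) (hhaG : j + 1 ≤ h + a)
    (hk₂j : k₂ ≤ j) (hk₂mid : S + (a : ℝ) * g * (1 - z) ≤ 2 * (k₂ : ℝ)) (hk₂h : k₂ < h)
    (hcheap : S + (a : ℝ) * g * (1 - z) - 2 * (k₁ : ℝ) ≤ y * ((h : ℝ) - k₁))
    (hsat : (1 - z) * lam * (1 - g) ≤ usage y (S + (a : ℝ) * g * (1 - z)) j (k₁ + a) k₂ * ((1 - z) * (1 - lam) * g)) :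
    ∃ θ : ℝ, 0 ≤ θ ∧ θ < 1 ∧
      DECAtT y (S + (a : ℝ) * g * (1 - z)) j (M + a)
        (fun p => θ * weakMidLaw S g h a p
          + (1 - θ) * (z * (if p = 0 then (1 : ℝ) else 0) + (1 - z) * slice (fun q => TP[k₁, k₂, lam, q]) a g p)) := by
  classical
  set t : ℝ := S + (a : ℝ) * g * (1 - z) with ht
  have h1z : 0 < 1 - z := by linarith
  have hg0 : 0 < g := by nlinarith
  have h1y : 0 < 1 - y := by linarith
  have ha0 : (0 : ℝ) ≤ a := Nat.cast_nonneg a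
  have hk0 : (0 : ℝ) ≤ k₁ := Nat.cast_nonneg k₁
  have hh0 : (0 : ℝ) < h := lt_trans hS0 hSh
  have hk₂h' : (k₂ : ℝ) < h := by exact_mod_cast hk₂h
  have hyh : y * (h : ℝ) ≤ S := le_trans (mul_le_mul_of_nonneg_left (by exact_mod_cast hhM) hy0.le) hta
  have hyk₂ : y * (k₂ : ℝ) ≤ S := le_trans (mul_le_mul_of_nonneg_left (by exact_mod_cast hk₂M) hy0.le) hta
  have hlam0' : 0 ≤ 1 - lam := by linarith
  have hagw0 : 0 ≤ (a : ℝ) * g * (1 - z) := mul_nonneg (mul_nonneg ha0 hg0.le) h1z.le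
  have hagwa : (a : ℝ) * g * (1 - z) ≤ a := by nlinarith [mul_nonneg ha0 hg0.le]
  have ht0 : 0 < t := by rw [ht]; linarith
  set m₁ : ℝ := (1 - z) * (1 - lam) * (1 - g) with hm₁
  set m₁' : ℝ := (1 - z) * (1 - lam) * g with hm₁'
  set m₂ : ℝ := (1 - z) * lam * (1 - g) with hm₂
  set m₂' : ℝ := (1 - z) * lam * g with hm₂'
  have hm₁0 : 0 ≤ m₁ := mul_nonneg (mul_nonneg h1z.le hlam0') (by linarith)
  have hm₁'0 : 0 ≤ m₁' := mul_nonneg (mul_nonneg h1z.le hlam0') hg0.le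
  have hm₂0 : 0 ≤ m₂ := mul_nonneg (mul_nonneg h1z.le hlam0) (by linarith)
  have hm₂'0 : 0 ≤ m₂' := mul_nonneg (mul_nonneg h1z.le hlam0) hg0.le
  have hΛ : (1 - z) * lam = m₂ + m₂' := by rw [hm₂, hm₂']; ring
  have hlam1' : lam < 1 := by
    by_contra hc
    have hl1 : lam = 1 := le_antisymm hlam1 (not_lt.1 hc)
    have e1 : m₁' = 0 := by rw [hm₁', hl1]; ring
    have e2 : m₂ = (1 - z) * (1 - g) := by rw [hm₂, hl1]; ring
    have h3 : m₂ ≤ 0 := by rw [e1, mul_zero] at hsat; exact hsat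
    rw [e2] at h3
    nlinarith [mul_pos h1z (show (0:ℝ) < 1 - g by linarith)]
  have hSk₂ : S < (k₂ : ℝ) := by
    have hkk : (0 : ℝ) < (k₂ : ℝ) - k₁ := by linarith
    have hk₂pos : (0 : ℝ) ≤ k₂ := Nat.cast_nonneg k₂
    have e : (k₂ : ℝ) - S = z * k₂ + (1 - z) * (1 - lam) * ((k₂ : ℝ) - k₁) := by rw [← hmean]; ring
    have p1 : 0 < (1 - z) * (1 - lam) * ((k₂ : ℝ) - k₁) := mul_pos (mul_pos h1z (by linarith)) hkk
    have p2 : 0 ≤ z * (k₂ : ℝ) := mul_nonneg hz0 hk₂pos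
    linarith only [e, p1, p2]
  set w₀ : ℝ := 1 - S / h with hw₀
  set Wh : ℝ := S / h * (1 - g) with hWh
  set WG : ℝ := S / h * g with hWG
  have hSh' : 0 < S / (h : ℝ) := div_pos hS0 hh0
  have hw0 : 0 ≤ w₀ := by rw [hw₀, sub_nonneg, div_le_one hh0]; exact hSh.le
  have hWhpos : 0 < Wh := mul_pos hSh' (by linarith)
  have hWG0 : 0 ≤ WG := mul_nonneg hSh'.le hg0.le
  have hcompk : t < ((k₁ + a : ℕ) : ℝ) + k₂ := by push_cast; rw [ht]; linarith
  have hcomph : t < ((k₁ + a : ℕ) : ℝ) + h := by linarith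
  have hcomp1h : t < (k₁ : ℝ) + h := by
    have hpos : (0 : ℝ) < (h : ℝ) - k₁ := by linarith
    have : y * ((h : ℝ) - k₁) < 1 * ((h : ℝ) - k₁) := mul_lt_mul_of_pos_right hy1 hpos
    linarith only [this, hcheap]
  have hlk : k₁ + a < k₂ := by
    have : ((k₁ + a : ℕ) : ℝ) < k₂ := by push_cast at hllow hcompk ⊢; linarith
    exact_mod_cast this
  have hlh : k₁ + a < h := by omega
  have hk1h : k₁ < h := by omega
  set Ulk : ℝ := usage y t j (k₁ + a) k₂ with hUlk
  set Ulh : ℝ := usage y t j (k₁ + a) h with hUlh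
  set U1h : ℝ := usage y t j k₁ h with hU1h
  have hUlkpos : 0 < Ulk := usage_pos_of_compat y t j (k₁ + a) k₂ hy0 hy1 hllow hlk (Or.inr hcompk)
  have hUlhpos : 0 < Ulh := usage_pos_of_compat y t j (k₁ + a) h hy0 hy1 hllow hlh (Or.inr hcomph)
  have hU1hpos : 0 < U1h := usage_pos_of_compat y t j k₁ h hy0 hy1 hk1low hk1h (Or.inr hcomp1h)
  have hUle : Ulh ≤ Ulk := by
    rw [hUlh, hUlk]
    refine usage_mid_le_of_rho_le y t t j (k₁ + a) (k₁ + a) h k₂ hy0 hy1 hhj hk₂j hllow hcompk ?_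
    have hD1 : (0 : ℝ) < (h : ℝ) - ((k₁ + a : ℕ) : ℝ) := by push_cast; push_cast at hcomph hllow; linarith
    have hD2 : (0 : ℝ) < (k₂ : ℝ) - ((k₁ + a : ℕ) : ℝ) := by push_cast; push_cast at hcompk hllow; linarith
    rw [div_le_div_iff₀ hD1 hD2]
    have : 0 ≤ t - 2 * ((k₁ + a : ℕ) : ℝ) := by linarith
    exact mul_le_mul_of_nonneg_left (by linarith) this
  have hU1u : U1h ≤ y / (1 - y) := by
    rw [hU1h]; exact usage_le_giant_of_light y t j k₁ h hy0 hy1 hhj hk1low hcomp1h hcheap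
  -- overflow and kink
  set α : ℝ := m₂ / Ulk with hα
  have hα0 : 0 ≤ α := div_nonneg hm₂0 hUlkpos.le
  have hαU : Ulk * α = m₂ := by rw [hα]; field_simp
  set N : ℝ := m₁' - α with hN
  have hN0 : 0 ≤ N := by rw [hN, hα, sub_nonneg, div_le_iff₀ hUlkpos]; linarith [hsat]
  set D : ℝ := Ulh * N + U1h * m₁ with hD
  have hD0 : 0 ≤ D := add_nonneg (mul_nonneg hUlhpos.le hN0) (mul_nonneg hU1hpos.le hm₁0)
  obtain ⟨θ, hθ⟩ : ∃ q : ℝ, q = D / (D + Wh) := ⟨_, rfl⟩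
  have hden : 0 < D + Wh := by linarith
  have hθ0 : 0 ≤ θ := by rw [hθ]; exact div_nonneg hD0 hden.le
  have hθ1 : θ < 1 := by rw [hθ, div_lt_one hden]; linarith
  have h1θ : 0 < 1 - θ := by linarith
  have hkink : θ * Wh = (1 - θ) * D := by rw [hθ]; field_simp; ring
  -- the giant inequality
  have hu : y / (1 - y) * w₀ - WG ≤ Wh := by
    have h1 : y / (1 - y) * w₀ ≤ S / h := by
      rw [hw₀, show (1 : ℝ) - S / h = ((h : ℝ) - S) / h by field_simp, show y / (1 - y) * (((h : ℝ) - S) / h) = y * ((h : ℝ) - S) / ((1 - y) * h) by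
        field_simp, div_le_div_iff₀ (mul_pos h1y hh0) hh0]
      have hx := mul_nonneg hh0.le (sub_nonneg.2 hyh)
      linarith only [hx]
    have e : S / (h : ℝ) = WG + Wh := by rw [hWG, hWh]; ring
    linarith only [h1, e]
  -- the pooled inequality of the pair (k₁, k₂), either status of k₁ at k₂
  have hDle : D + y / (1 - y) * z ≤ m₂' := by
    have h1 : Ulh * N ≤ Ulk * N := mul_le_mul_of_nonneg_right hUle hN0
    have h2 : Ulk * N = Ulk * m₁' - m₂ := by rw [hN, mul_sub, hαU]
    by_cases hck : t - 2 * (k₁ : ℝ) ≤ y * ((k₂ : ℝ) - k₁)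
    · have hpool := pooled_cheap y z g S lam j k₂ a k₁ hy0 hy1 hz0 hz1.le hg0.le hg1.le hlam1 hk₂j hSk₂ hyk₂ hmean hllow hk₂mid hck
      rw [← hUlk, ← hm₁', ← hm₁, hΛ] at hpool
      have hcomp1k : t < (k₁ : ℝ) + k₂ := by
        have hpos : (0 : ℝ) < (k₂ : ℝ) - k₁ := by linarith
        have : y * ((k₂ : ℝ) - k₁) < 1 * ((k₂ : ℝ) - k₁) := mul_lt_mul_of_pos_right hy1 hpos
        linarith only [this, hck]
      have hU1le : U1h ≤ usage y t j k₁ k₂ := by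
        rw [hU1h]
        refine usage_mid_le_of_rho_le y t t j k₁ k₁ h k₂ hy0 hy1 hhj hk₂j hk1low hcomp1k ?_
        have hD1 : (0 : ℝ) < (h : ℝ) - k₁ := by linarith
        have hD2 : (0 : ℝ) < (k₂ : ℝ) - k₁ := by linarith
        rw [div_le_div_iff₀ hD1 hD2]
        have : 0 ≤ t - 2 * (k₁ : ℝ) := by linarith
        exact mul_le_mul_of_nonneg_left (by linarith) this
      have h3 : U1h * m₁ ≤ usage y t j k₁ k₂ * m₁ := mul_le_mul_of_nonneg_right hU1le hm₁0
      rw [hD]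
      linarith [hpool, h1, h2, h3]
    · push Not at hck
      have hpool := pooled_dear y z g S lam j k₂ a k₁ hy0 hy1 hz0 hz1.le hg0.le hg1.le hlam1 hk₂j hSk₂ hyk₂ hmean hllow hck.le
      rw [← hUlk, ← hm₁', ← hm₁, hΛ] at hpool
      have h3 : U1h * m₁ ≤ y / (1 - y) * m₁ := mul_le_mul_of_nonneg_right hU1u hm₁0
      rw [hD]
      linarith [hpool, h1, h2, h3]
  have hG : y / (1 - y) * ((θ * w₀ + (1 - θ) * z) + 0) ≤ θ * WG + (1 - θ) * m₂' := by
    have h1 : θ * (y / (1 - y) * w₀ - WG) ≤ θ * Wh := mul_le_mul_of_nonneg_left hu hθ0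
    have h2 : D ≤ m₂' - y / (1 - y) * z := by linarith
    have h3 : (1 - θ) * D ≤ (1 - θ) * (m₂' - y / (1 - y) * z) := mul_le_mul_of_nonneg_left h2 h1θ.le
    linarith [h1, h3, hkink]
  have Pk := flowAtT_pair y t j (M + a) (k₁ + a) k₂ ((1 - θ) * α) ((1 - θ) * m₂) hlj hllow (by omega) (Or.inr hk₂mid)
    (Or.inr hcompk) (mul_nonneg h1θ.le hα0) (le_of_eq (by rw [← hUlk, ← hαU]; ring))
  have hhmid : t ≤ 2 * (h : ℝ) := by linarith
  have Ph := flowAtT_pair y t j (M + a) (k₁ + a) h ((1 - θ) * N) (Ulh * ((1 - θ) * N)) hlj hllow (by omega) (Or.inr hhmid)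
    (Or.inr hcomph) (mul_nonneg h1θ.le hN0) (by rw [← hUlh])
  have P1 := flowAtT_pair y t j (M + a) k₁ h ((1 - θ) * m₁) (θ * Wh - Ulh * ((1 - θ) * N)) hk₁j hk1low (by omega) (Or.inr hhmid)
    (Or.inr hcomp1h) (mul_nonneg h1θ.le hm₁0) (by rw [← hU1h]; nlinarith [hkink])
  have Pg := flowAtT_lows_giants₂ y t j (M + a) k₁ (h + a) (k₂ + a) (θ * w₀ + (1 - θ) * z) 0 (θ * WG) ((1 - θ) * m₂')
    hy0 hy1 (add_nonneg (mul_nonneg hθ0 hw0) (mul_nonneg h1θ.le hz0)) le_rfl (mul_nonneg hθ0 hWG0)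
    (mul_nonneg h1θ.le hm₂'0) hk₁j hk1low hhaG (by omega) hk₂aG (by omega) (by linarith [hG])
  -- assemble
  have hsum := FlowAtT.add (FlowAtT.add (FlowAtT.add Pk Ph) P1) Pg
  have hflow : FlowAtT y t j (M + a) (fun p => θ * weakMidLaw S g h a p
      + (1 - θ) * (z * (if p = 0 then (1 : ℝ) else 0) + (1 - z) * slice (fun q => TP[k₁, k₂, lam, q]) a g p)) := by
    refine (congrArg (FlowAtT y t j (M + a)) (funext fun p => ?_)).mp hsum
    rw [movedTwoPoint_apply, ← hm₁, ← hm₁', ← hm₂, ← hm₂']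
    unfold weakMidLaw
    rw [← hw₀, ← hWh, ← hWG]
    have eN : (1 - θ) * m₁' = (1 - θ) * α + (1 - θ) * N := by rw [hN]; ring
    linear_combination (-(if p = k₁ + a then (1 : ℝ) else 0)) * eN
  exact gatedSliceMixLaw_conclusion_of_flowAtT y z g S lam θ a j M h k₁ k₂ hy0 hy1 hhM hk hk₂M hθ0 hθ1 hflow

set_option maxHeartbeats 1600000 in
/-- **REGIME B, TWO MIDS `k₂ < h`, `k₂` UNSATURATED by the shifted low but SATURATED with the cheap unshifted low — the conclusion of
`GatedSliceMixLaw'`.**  Frame as `gatedSliceMixLaw_regimeB_twoMid_dear`; `U(ℓ,k₂)m₁' ≤ m₂ ≤ U(ℓ,k₂)m₁' + U(k₁,k₂)m₁` with `k₁` light at `k₂`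
(`t − 2k₁ ≤ y(k₂ − k₁)`, hence light at `h > k₂`).  Flow: `ℓ → k₂` entirely, `k₁` fills the rest of `k₂`, the overflow
`m₁ − (m₂ − U(ℓ,k₂)m₁')/U(k₁,k₂)` of `k₁` rides `W_h`'s mid, zeros ride the giants; `θ` at the kink; giant inequality from `pooled_cheap` (top `k₂`)
and `U(k₁,h) ≤ U(k₁,k₂)`.  (The fully unsaturated remainder `m₂ > U(ℓ,k₂)m₁' + [cheap]U(k₁,k₂)m₁` is a θ = 0 cell.) [this work] -/
theorem gatedSliceMixLaw_regimeB_twoMid_unsat (y z g S lam : ℝ) (a j M h k₁ k₂ : ℕ)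
    (hy0 : 0 < y) (hy1 : y < 1) (hz0 : 0 ≤ z) (hz1 : z < 1) (hg1 : g < 1) (hyg : y ≤ (1 - z) * g)
    (hS0 : 0 < S) (hta : y * (M : ℝ) ≤ S) (hhj : h ≤ j) (hhM : h ≤ M) (hSh : S < (h : ℝ))
    (hk : k₁ ≤ k₂) (hk₂M : k₂ ≤ M) (hlam0 : 0 ≤ lam) (hlam1 : lam ≤ 1)
    (hmean : (1 - z) * ((k₁ : ℝ) + ((k₂ : ℝ) - k₁) * lam) = S)
    (hk₁j : k₁ ≤ j) (hk1low : 2 * (k₁ : ℝ) < S + (a : ℝ) * g * (1 - z))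
    (hllow : 2 * ((k₁ + a : ℕ) : ℝ) < S + (a : ℝ) * g * (1 - z)) (hlj : k₁ + a ≤ j) (hk₂aG : j + 1 ≤ k₂ + a) (hhaG : j + 1 ≤ h + a)
    (hk₂j : k₂ ≤ j) (hk₂mid : S + (a : ℝ) * g * (1 - z) ≤ 2 * (k₂ : ℝ)) (hk₂h : k₂ < h)
    (hcheapk : S + (a : ℝ) * g * (1 - z) - 2 * (k₁ : ℝ) ≤ y * ((k₂ : ℝ) - k₁))
    (hunsat : usage y (S + (a : ℝ) * g * (1 - z)) j (k₁ + a) k₂ * ((1 - z) * (1 - lam) * g) ≤ (1 - z) * lam * (1 - g))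
    (hsat : (1 - z) * lam * (1 - g) ≤ usage y (S + (a : ℝ) * g * (1 - z)) j (k₁ + a) k₂ * ((1 - z) * (1 - lam) * g)
      + usage y (S + (a : ℝ) * g * (1 - z)) j k₁ k₂ * ((1 - z) * (1 - lam) * (1 - g))) :
    ∃ θ : ℝ, 0 ≤ θ ∧ θ < 1 ∧
      DECAtT y (S + (a : ℝ) * g * (1 - z)) j (M + a)
        (fun p => θ * weakMidLaw S g h a p
          + (1 - θ) * (z * (if p = 0 then (1 : ℝ) else 0) + (1 - z) * slice (fun q => TP[k₁, k₂, lam, q]) a g p)) := by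
  classical
  set t : ℝ := S + (a : ℝ) * g * (1 - z) with ht
  have h1z : 0 < 1 - z := by linarith
  have hg0 : 0 < g := by nlinarith
  have h1y : 0 < 1 - y := by linarith
  have ha0 : (0 : ℝ) ≤ a := Nat.cast_nonneg a
  have hk0 : (0 : ℝ) ≤ k₁ := Nat.cast_nonneg k₁
  have hh0 : (0 : ℝ) < h := lt_trans hS0 hSh
  have hk₂h' : (k₂ : ℝ) < h := by exact_mod_cast hk₂h
  have hyh : y * (h : ℝ) ≤ S := le_trans (mul_le_mul_of_nonneg_left (by exact_mod_cast hhM) hy0.le) hta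
  have hcheap : t - 2 * (k₁ : ℝ) ≤ y * ((h : ℝ) - k₁) := by
    have : y * (k₂ : ℝ) ≤ y * h := mul_le_mul_of_nonneg_left hk₂h'.le hy0.le
    linarith only [this, hcheapk]
  have hyk₂ : y * (k₂ : ℝ) ≤ S := le_trans (mul_le_mul_of_nonneg_left (by exact_mod_cast hk₂M) hy0.le) hta
  have hlam0' : 0 ≤ 1 - lam := by linarith
  have hagw0 : 0 ≤ (a : ℝ) * g * (1 - z) := mul_nonneg (mul_nonneg ha0 hg0.le) h1z.le
  have hagwa : (a : ℝ) * g * (1 - z) ≤ a := by nlinarith [mul_nonneg ha0 hg0.le]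
  have ht0 : 0 < t := by rw [ht]; linarith
  set m₁ : ℝ := (1 - z) * (1 - lam) * (1 - g) with hm₁
  set m₁' : ℝ := (1 - z) * (1 - lam) * g with hm₁'
  set m₂ : ℝ := (1 - z) * lam * (1 - g) with hm₂
  set m₂' : ℝ := (1 - z) * lam * g with hm₂'
  have hm₁0 : 0 ≤ m₁ := mul_nonneg (mul_nonneg h1z.le hlam0') (by linarith)
  have hm₁'0 : 0 ≤ m₁' := mul_nonneg (mul_nonneg h1z.le hlam0') hg0.le
  have hm₂0 : 0 ≤ m₂ := mul_nonneg (mul_nonneg h1z.le hlam0) (by linarith)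
  have hm₂'0 : 0 ≤ m₂' := mul_nonneg (mul_nonneg h1z.le hlam0) hg0.le
  have hΛ : (1 - z) * lam = m₂ + m₂' := by rw [hm₂, hm₂']; ring
  have hlam1' : lam < 1 := by
    by_contra hc
    have hl1 : lam = 1 := le_antisymm hlam1 (not_lt.1 hc)
    have e1 : m₁' = 0 := by rw [hm₁', hl1]; ring
    have e1b : m₁ = 0 := by rw [hm₁, hl1]; ring
    have e2 : m₂ = (1 - z) * (1 - g) := by rw [hm₂, hl1]; ring
    have h3 : m₂ ≤ 0 := by rw [e1, e1b, mul_zero, mul_zero, add_zero] at hsat; exact hsat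
    rw [e2] at h3
    nlinarith [mul_pos h1z (show (0:ℝ) < 1 - g by linarith)]
  have hSk₂ : S < (k₂ : ℝ) := by
    have hkk : (0 : ℝ) < (k₂ : ℝ) - k₁ := by linarith
    have hk₂pos : (0 : ℝ) ≤ k₂ := Nat.cast_nonneg k₂
    have e : (k₂ : ℝ) - S = z * k₂ + (1 - z) * (1 - lam) * ((k₂ : ℝ) - k₁) := by rw [← hmean]; ring
    have p1 : 0 < (1 - z) * (1 - lam) * ((k₂ : ℝ) - k₁) := mul_pos (mul_pos h1z (by linarith)) hkk
    have p2 : 0 ≤ z * (k₂ : ℝ) := mul_nonneg hz0 hk₂pos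
    linarith only [e, p1, p2]
  set w₀ : ℝ := 1 - S / h with hw₀
  set Wh : ℝ := S / h * (1 - g) with hWh
  set WG : ℝ := S / h * g with hWG
  have hSh' : 0 < S / (h : ℝ) := div_pos hS0 hh0
  have hw0 : 0 ≤ w₀ := by rw [hw₀, sub_nonneg, div_le_one hh0]; exact hSh.le
  have hWhpos : 0 < Wh := mul_pos hSh' (by linarith)
  have hWG0 : 0 ≤ WG := mul_nonneg hSh'.le hg0.le
  have hcompk : t < ((k₁ + a : ℕ) : ℝ) + k₂ := by push_cast; rw [ht]; linarith
  have hcomph : t < ((k₁ + a : ℕ) : ℝ) + h := by linarith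
  have hcomp1h : t < (k₁ : ℝ) + h := by
    have hpos : (0 : ℝ) < (h : ℝ) - k₁ := by linarith
    have : y * ((h : ℝ) - k₁) < 1 * ((h : ℝ) - k₁) := mul_lt_mul_of_pos_right hy1 hpos
    linarith only [this, hcheap]
  have hlk : k₁ + a < k₂ := by
    have : ((k₁ + a : ℕ) : ℝ) < k₂ := by push_cast at hllow hcompk ⊢; linarith
    exact_mod_cast this
  have hlh : k₁ + a < h := by omega
  have hk1h : k₁ < h := by omega
  set Ulk : ℝ := usage y t j (k₁ + a) k₂ with hUlk
  set Ulh : ℝ := usage y t j (k₁ + a) h with hUlh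
  set U1h : ℝ := usage y t j k₁ h with hU1h
  set U1k : ℝ := usage y t j k₁ k₂ with hU1k
  have hUlkpos : 0 < Ulk := usage_pos_of_compat y t j (k₁ + a) k₂ hy0 hy1 hllow hlk (Or.inr hcompk)
  have hUlhpos : 0 < Ulh := usage_pos_of_compat y t j (k₁ + a) h hy0 hy1 hllow hlh (Or.inr hcomph)
  have hU1hpos : 0 < U1h := usage_pos_of_compat y t j k₁ h hy0 hy1 hk1low hk1h (Or.inr hcomp1h)
  have hcomp1k : t < (k₁ : ℝ) + k₂ := by
    have hpos : (0 : ℝ) < (k₂ : ℝ) - k₁ := by linarith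
    have : y * ((k₂ : ℝ) - k₁) < 1 * ((k₂ : ℝ) - k₁) := mul_lt_mul_of_pos_right hy1 hpos
    linarith only [this, hcheapk]
  have hk1k : k₁ < k₂ := by omega
  have hU1kpos : 0 < U1k := usage_pos_of_compat y t j k₁ k₂ hy0 hy1 hk1low hk1k (Or.inr hcomp1k)
  have hU1le : U1h ≤ U1k := by
    rw [hU1h, hU1k]
    refine usage_mid_le_of_rho_le y t t j k₁ k₁ h k₂ hy0 hy1 hhj hk₂j hk1low hcomp1k ?_
    have hD1 : (0 : ℝ) < (h : ℝ) - k₁ := by linarith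
    have hD2 : (0 : ℝ) < (k₂ : ℝ) - k₁ := by linarith
    rw [div_le_div_iff₀ hD1 hD2]
    have : 0 ≤ t - 2 * (k₁ : ℝ) := by linarith
    exact mul_le_mul_of_nonneg_left (by linarith) this
  have hUle : Ulh ≤ Ulk := by
    rw [hUlh, hUlk]
    refine usage_mid_le_of_rho_le y t t j (k₁ + a) (k₁ + a) h k₂ hy0 hy1 hhj hk₂j hllow hcompk ?_
    have hD1 : (0 : ℝ) < (h : ℝ) - ((k₁ + a : ℕ) : ℝ) := by push_cast; push_cast at hcomph hllow; linarith
    have hD2 : (0 : ℝ) < (k₂ : ℝ) - ((k₁ + a : ℕ) : ℝ) := by push_cast; push_cast at hcompk hllow; linarith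
    rw [div_le_div_iff₀ hD1 hD2]
    have : 0 ≤ t - 2 * ((k₁ + a : ℕ) : ℝ) := by linarith
    exact mul_le_mul_of_nonneg_left (by linarith) this
  have hU1u : U1h ≤ y / (1 - y) := by
    rw [hU1h]; exact usage_le_giant_of_light y t j k₁ h hy0 hy1 hhj hk1low hcomp1h hcheap
  -- the rest of k₂ after the shifted low, taken by k₁; the overflow of k₁ rides W's mid
  set L₀ : ℝ := m₂ - Ulk * m₁' with hL₀
  have hL₀0 : 0 ≤ L₀ := by rw [hL₀]; linarith [hunsat]
  set β : ℝ := L₀ / U1k with hβ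
  have hβ0 : 0 ≤ β := div_nonneg hL₀0 hU1kpos.le
  have hβU : U1k * β = L₀ := by rw [hβ]; field_simp
  have hβle : β ≤ m₁ := by
    rw [hβ, div_le_iff₀ hU1kpos, hL₀]
    linarith [hsat]
  set D : ℝ := U1h * (m₁ - β) with hD
  have hD0 : 0 ≤ D := mul_nonneg hU1hpos.le (by linarith)
  obtain ⟨θ, hθ⟩ : ∃ q : ℝ, q = D / (D + Wh) := ⟨_, rfl⟩
  have hden : 0 < D + Wh := by linarith
  have hθ0 : 0 ≤ θ := by rw [hθ]; exact div_nonneg hD0 hden.le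
  have hθ1 : θ < 1 := by rw [hθ, div_lt_one hden]; linarith
  have h1θ : 0 < 1 - θ := by linarith
  have hkink : θ * Wh = (1 - θ) * D := by rw [hθ]; field_simp; ring
  -- the giant inequality
  have hu : y / (1 - y) * w₀ - WG ≤ Wh := by
    have h1 : y / (1 - y) * w₀ ≤ S / h := by
      rw [hw₀, show (1 : ℝ) - S / h = ((h : ℝ) - S) / h by field_simp, show y / (1 - y) * (((h : ℝ) - S) / h) = y * ((h : ℝ) - S) / ((1 - y) * h) by
        field_simp, div_le_div_iff₀ (mul_pos h1y hh0) hh0]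
      have hx := mul_nonneg hh0.le (sub_nonneg.2 hyh)
      linarith only [hx]
    have e : S / (h : ℝ) = WG + Wh := by rw [hWG, hWh]; ring
    linarith only [h1, e]
  have hDle : D + y / (1 - y) * z ≤ m₂' := by
    have hpool := pooled_cheap y z g S lam j k₂ a k₁ hy0 hy1 hz0 hz1.le hg0.le hg1.le hlam1 hk₂j hSk₂ hyk₂ hmean hllow hk₂mid hcheapk
    rw [← hUlk, ← hU1k, ← hm₁', ← hm₁, hΛ] at hpool
    have h1 : D ≤ U1k * (m₁ - β) := mul_le_mul_of_nonneg_right hU1le (by linarith)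
    have h2 : U1k * (m₁ - β) = U1k * m₁ - L₀ := by rw [mul_sub, hβU]
    rw [hL₀] at h2
    linarith [hpool, h1, h2]
  have hG : y / (1 - y) * ((θ * w₀ + (1 - θ) * z) + 0) ≤ θ * WG + (1 - θ) * m₂' := by
    have h1 : θ * (y / (1 - y) * w₀ - WG) ≤ θ * Wh := mul_le_mul_of_nonneg_left hu hθ0
    have h2 : D ≤ m₂' - y / (1 - y) * z := by linarith
    have h3 : (1 - θ) * D ≤ (1 - θ) * (m₂' - y / (1 - y) * z) := mul_le_mul_of_nonneg_left h2 h1θ.le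
    linarith [h1, h3, hkink]
  have Pk := flowAtT_pair y t j (M + a) (k₁ + a) k₂ ((1 - θ) * m₁') (Ulk * ((1 - θ) * m₁')) hlj hllow (by omega) (Or.inr hk₂mid)
    (Or.inr hcompk) (mul_nonneg h1θ.le hm₁'0) (by rw [← hUlk])
  have Pk1 := flowAtT_pair y t j (M + a) k₁ k₂ ((1 - θ) * β) ((1 - θ) * L₀) hk₁j hk1low (by omega) (Or.inr hk₂mid)
    (Or.inr hcomp1k) (mul_nonneg h1θ.le hβ0) (le_of_eq (by rw [← hU1k, ← hβU]; ring))
  have hhmid : t ≤ 2 * (h : ℝ) := by linarith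
  have P1 := flowAtT_pair y t j (M + a) k₁ h ((1 - θ) * (m₁ - β)) (θ * Wh) hk₁j hk1low (by omega) (Or.inr hhmid)
    (Or.inr hcomp1h) (mul_nonneg h1θ.le (by linarith)) (by rw [← hU1h]; nlinarith [hkink])
  have Pg := flowAtT_lows_giants₂ y t j (M + a) k₁ (h + a) (k₂ + a) (θ * w₀ + (1 - θ) * z) 0 (θ * WG) ((1 - θ) * m₂')
    hy0 hy1 (add_nonneg (mul_nonneg hθ0 hw0) (mul_nonneg h1θ.le hz0)) le_rfl (mul_nonneg hθ0 hWG0)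
    (mul_nonneg h1θ.le hm₂'0) hk₁j hk1low hhaG (by omega) hk₂aG (by omega) (by linarith [hG])
  -- assemble
  have hsum := FlowAtT.add (FlowAtT.add (FlowAtT.add Pk Pk1) P1) Pg
  have hflow : FlowAtT y t j (M + a) (fun p => θ * weakMidLaw S g h a p
      + (1 - θ) * (z * (if p = 0 then (1 : ℝ) else 0) + (1 - z) * slice (fun q => TP[k₁, k₂, lam, q]) a g p)) := by
    refine (congrArg (FlowAtT y t j (M + a)) (funext fun p => ?_)).mp hsum
    rw [movedTwoPoint_apply, ← hm₁, ← hm₁', ← hm₂, ← hm₂']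
    unfold weakMidLaw
    rw [← hw₀, ← hWh, ← hWG]
    have eL : (1 - θ) * m₂ = Ulk * ((1 - θ) * m₁') + (1 - θ) * L₀ := by rw [hL₀]; ring
    have eβ : (1 - θ) * m₁ = (1 - θ) * β + (1 - θ) * (m₁ - β) := by ring
    linear_combination (-(if p = k₂ then (1 : ℝ) else 0)) * eL - (if p = k₁ then (1 : ℝ) else 0) * eβ
  exact gatedSliceMixLaw_conclusion_of_flowAtT y z g S lam θ a j M h k₁ k₂ hy0 hy1 hhM hk hk₂M hθ0 hθ1 hflow

end LawDec

end Quant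

end Summit.CriticalPhenomena.PercolationContinuityZ3.Theorems
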